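import Literature.IUT.LogThetaLattice.PacketLogVolumesHaarModelCapsulesNonarch
import Literature.IUT.LogVolume.ArchimedeanPacketCoordScaling
import HarnessLib

/-!
# [IUTchIII] Proposition 3.9 (iii) at the GENUINE adelic Haar model, capsules `|A| ≥ 2` — II. the archimedean packet
# `M_A = ⊗_{α∈A} ⊕_{w|∞} ℂ`, the global capsule log-volume, and its invariance under `(†𝕄⊛_mod)_α` (product formula)

S. Mochizuki, *Inter-universal Teichmüller theory III*, kurims manuscript (May 2020), §3, Proposition 3.9 (i) p. 116 (at
`∞`: "the sum of the radial log-volumes … normalized so that multiplication … by `e` corresponds to adding … `log(e)`")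
and (iii) p. 117 ("by adding the log-volumes … at the various `v_ℚ ∈ 𝕍_ℚ` one obtains a global log-volume … which is
invariant with respect to multiplication by elements of `(†𝕄⊛_mod)_α = (†𝕄⊛_MOD)_α ⊆ 𝓘^ℚ(^A𝓕_{𝕍_ℚ})`"); Remark 3.1.1
(ii)–(iv) pp. 94–97; [IUTchIV] Prop. 1.5 (iii) p. 15 (the direct sum decomposition of the archimedean tensor packet).
[claim: Mochizuki2012, status: disputed] for every [IUTchIII] sentence.

abc-iut cell, layer L6, row «CAP39» (L6-lead §F v1.18h (1)); second of two files, over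
`PacketLogVolumesHaarModelCapsulesNonarch.lean` (portions at `p`, `nonarchCapsuleLogVolume_act`). Inputs consumed BY
NAME: abc-iut-L5-t7's tensor copies `M_A = MI A (InfinitePlace F)` with the canonical decomposition
`Φ₀ : M_A ≅ ⊕_{(w⃗,ε)} ℂ` and `packetLogVol Φ₀`; abc-iut-w5-d178's element-scaling law `packetLogVol_image_tprod_mul`,
`image_mul_eq_coordMul`, `volume_image_coordMul` (p417264); abc-iut-L6-d3's `packetLogModulus`,
`finite_support_packetLogModulus`, `finsum_packetLogModulus_eq_zero` (= the product formula regrouped by rational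
places, p415871); abc-iut-L6-t5's `Prop39iii_invariance_of_productFormula`.

WHAT IS TYPED: at `∞` the genuine packet `M_A` with regions of positive finite volume in the canonical coordinates and
`μ^log_{A,∞} := packetLogVol Φ₀` (unit polydisc ↦ `0`, `×e ↦ +1`); the action of `f ∈ F^×` through the label `α` =
multiplication by the pure tensor `⊗_β m_β`, `m_α = (σ_w(f))_w`, `m_β = 1` (`β ≠ α`); the capsule regions / log-volumes
/ actions at every `v_ℚ ∈ 𝕍_ℚ` (`HaarCapsuleRegion`, `haarCapsuleLogVolume`, `haarCapsuleAct`), the action on GLOBAL regions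
(`haarCapsulePrincipalAction`: "zero log-volume for all but finitely many `v_ℚ`" is kept). PROVED: `archCapsuleLogVolume_act`
(`μ^log_{A,∞}((α,f)·S) = μ^log_{A,∞}(S) + (1/|𝕍^arc|)·Σ_w log|f|_w`: d178's law + the counting
`Σ_{(w⃗,ε)} g(w⃗ α) = (|Idx|/|𝕍^arc|)·Σ_w g(w)`); for `F` TOTALLY COMPLEX ([IUTchI] Def 3.1 (b) `√−1 ∈ F`; L5-t7's `M_A`
puts a copy of `ℂ` at every archimedean place, `[F_w:ℝ] = 2`, `[F:ℚ] = 2|𝕍^arc|`) this is Σ_w ([F_w:ℝ]/[F:ℚ])·log|f|_w`,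
so at EVERY `v_ℚ` the capsule packet moves by abc-iut-L6-d3's `packetLogModulus F f v_ℚ` (`haarCapsuleLogVolume_act`), whence
**`prop39iii_invariance_haarModelCapsules`**: `Prop39iii_invariance (haarCapsuleLogVolume F A) (haarCapsulePrincipalAction F A)`
for the action of `A × F^×`, `F` totally complex. HONEST SCOPE: as file I; the archimedean packet is L5-t7's all-complex
`M_A`, hence the hypothesis `htc` (the IUT case); for `F` with real places the genuine portion `⊗_α F_{w_α}` has
`ℝ`-factors and is not this `M_A` (not typed). Classical (Lebesgue/Haar measure + the product formula); nothing here
constructs `(†𝓕⊛_mod)_α`, asserts anything about [IUTchIII] Cor. 3.12, or takes a side; typed ≠ endorsed.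
-/

noncomputable section

namespace Literature.IUT.LogThetaLattice

open Literature.IUT.LogVolume Literature.NumberTheory.NumberFields NumberField IsDedekindDomain MeasureTheory Set
open scoped ENNReal NNReal Pointwise

variable (F : Type) [Field F] [NumberField F]
variable (A : Type) [Fintype A] [DecidableEq A] [Nonempty A]

/-! ### §3. The capsule packet at `∞`: abc-iut-L5-t7's `M_A = ⊗_{α∈A} ⊕_{w|∞} ℂ` in canonical coordinates -/

section Arch

open Literature.IUT.LogVolume.Prop15iii Literature.IUT.LogVolume.ArchPacket PiTensorProduct

/-- A CAPSULE REGION at `∞`: a subset of the genuine archimedean packet `M_A` of positive finite volume in the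
canonical coordinates `Φ₀ : M_A ≅ ⊕_{(w⃗,ε)} ℂ` ([IUTchIV] Prop. 1.5 (iii); [IUTchIII] Prop. 3.9 (i) p. 116).
[claim: Mochizuki2012, status: disputed] -/
def ArchCapsuleRegion : Type :=
  {S : Set (MI A (InfinitePlace F)) //
    volume ((canonicalDecomposition A (InfinitePlace F) : MI A (InfinitePlace F) → (Idx A (InfinitePlace F) → ℂ)) '' S)
        ≠ 0 ∧
      volume ((canonicalDecomposition A (InfinitePlace F) :
          MI A (InfinitePlace F) → (Idx A (InfinitePlace F) → ℂ)) '' S) ≠ ∞}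

/-- **`μ^log_{A,∞}`**: the packet log-volume of abc-iut-L5-t7 in the canonical coordinates (normalised: the unit
polydisc has log-volume `0`; multiplication by `e` adds `1`). [claim: Mochizuki2012, status: disputed] -/
def archCapsuleLogVolume (S : ArchCapsuleRegion F A) : ℝ :=
  packetLogVol (canonicalDecomposition A (InfinitePlace F)) S.1

/-- The pure-tensor factor by which `f ∈ F^×` acts THROUGH THE LABEL `α` on `M_A`: `m_α = (σ_w(f))_{w|∞}`,
`m_β = 1` for `β ≠ α`. [claim: Mochizuki2012, status: disputed] -/
def archFactor (α : A) (f : Fˣ) : A → M (InfinitePlace F) :=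
  fun β w => if β = α then w.embedding (f : F) else 1

omit [Fintype A] [Nonempty A] [NumberField F] in
/-- All entries of the factor are nonzero. [claim: Mochizuki2012, status: disputed] -/
theorem archFactor_ne_zero (α : A) (f : Fˣ) (β : A) (w : InfinitePlace F) : archFactor F A α f β w ≠ 0 := by
  unfold archFactor
  split_ifs
  · exact (map_ne_zero w.embedding).mpr f.ne_zero
  · exact one_ne_zero

omit [Fintype A] [Nonempty A] [NumberField F] in
/-- `Σ_β log|m_β(w⃗ β)| = log|σ_{w⃗ α}(f)|` (the other factors are `1`). [claim: Mochizuki2012, status: disputed] -/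
theorem sum_log_norm_archFactor [Fintype A] (α : A) (f : Fˣ) (wA : A → InfinitePlace F) :
    ∑ β, Real.log ‖archFactor F A α f β (wA β)‖ = Real.log ((wA α) (f : F)) := by
  rw [Finset.sum_eq_single α]
  · simp [archFactor, InfinitePlace.norm_embedding_eq]
  · intro β _ hβ
    simp [archFactor, hβ]
  · intro h; exact absurd (Finset.mem_univ α) h

/-- **The action of `f ∈ F^×` through the label `α`** on capsule regions at `∞`: multiplication by the pure tensor
`⊗_β m_β`; positive finite volume is kept (`vol(Φ₀(t·S)) = (Π_j |Φ₀(t)_j|²)·vol(Φ₀ S)`, abc-iut-w5-d178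
`volume_image_coordMul`). [claim: Mochizuki2012, status: disputed] -/
def archCapsuleAct (α : A) (f : Fˣ) (S : ArchCapsuleRegion F A) : ArchCapsuleRegion F A :=
  ⟨(fun x => tprod ℝ (archFactor F A α f) * x) '' S.1, by
    have hcoord := image_mul_eq_coordMul (canonicalDecomposition A (InfinitePlace F)) (tprod ℝ (archFactor F A α f)) S.1
    have hne : ∀ idx : Idx A (InfinitePlace F),
        canonicalDecomposition A (InfinitePlace F) (tprod ℝ (archFactor F A α f)) idx ≠ 0 := fun idx =>
      (log_norm_canonicalDecomposition_tprod (archFactor F A α f) (archFactor_ne_zero F A α f) idx).1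
    have hprod : 0 < ∏ j, ‖canonicalDecomposition A (InfinitePlace F) (tprod ℝ (archFactor F A α f)) j‖ ^ 2 :=
      Finset.prod_pos fun j _ => pow_pos (norm_pos_iff.mpr (hne j)) 2
    rw [hcoord, volume_image_coordMul]
    exact ⟨mul_ne_zero (by simpa using hprod) S.2.1, ENNReal.mul_ne_top ENNReal.ofReal_ne_top S.2.2⟩⟩

/-- Underlying set of `(α,f)·S`. [claim: Mochizuki2012, status: disputed] -/
@[simp] theorem archCapsuleAct_val (α : A) (f : Fˣ) (S : ArchCapsuleRegion F A) :
    (archCapsuleAct F A α f S).1 = (fun x => tprod ℝ (archFactor F A α f) * x) '' S.1 := rfl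

omit [DecidableEq A] [Nonempty A] [NumberField F] in
/-- `Σ_{w⃗ : A → V} g(w⃗ α) = |V|^{|A|−1} · Σ_w g(w)` (counting helper). [folklore] -/
private theorem sum_pi_apply_eq_card_pow_mul (V : Type) [Fintype V] [DecidableEq A] (α : A) (g : V → ℝ) :
    ∑ wA : A → V, g (wA α) = (Fintype.card V : ℝ) ^ (Fintype.card A - 1) * ∑ w, g w := by
  classical
  have step1 : ∑ wA : A → V, g (wA α) = ∑ x : V × ({β : A // β ≠ α} → V), g x.1 :=
    Fintype.sum_equiv (Equiv.piSplitAt α fun _ : A => V) _ _ fun _ => rfl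
  rw [step1, Fintype.sum_prod_type]
  simp only [Finset.sum_const, Finset.card_univ, nsmul_eq_mul]
  rw [Finset.mul_sum]
  refine Finset.sum_congr rfl fun w _ => ?_
  rw [Fintype.card_fun, Fintype.card_subtype_compl, Fintype.card_subtype_eq]
  push_cast
  ring

/-- **Counting in the canonical coordinates** (`Idx = V^A × {±}^{A∖{α₀}}`): the average over `(w⃗, ε)` of `g(w⃗ α)`
is the average over `w ∈ V` of `g(w)`. [claim: Mochizuki2012, status: disputed] -/
theorem idxAverage_eq (α : A) (g : InfinitePlace F → ℝ) :
    (Fintype.card (Idx A (InfinitePlace F)) : ℝ)⁻¹ * ∑ idx : Idx A (InfinitePlace F), g (idx.1 α) =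
      (Fintype.card (InfinitePlace F) : ℝ)⁻¹ * ∑ w : InfinitePlace F, g w := by
  classical
  have hV : (0 : ℝ) < Fintype.card (InfinitePlace F) := by exact_mod_cast Fintype.card_pos
  have hA : 1 ≤ Fintype.card A := Fintype.card_pos
  rw [Fintype.sum_prod_type]
  simp_rw [Finset.sum_const, Finset.card_univ, nsmul_eq_mul]
  rw [← Finset.mul_sum, sum_pi_apply_eq_card_pow_mul A (InfinitePlace F) α g, Fintype.card_prod, Fintype.card_fun]
  have hpow : (Fintype.card (InfinitePlace F) : ℝ) ^ Fintype.card A =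
      (Fintype.card (InfinitePlace F) : ℝ) ^ (Fintype.card A - 1) * Fintype.card (InfinitePlace F) := by
    rw [← pow_succ, Nat.sub_add_cancel hA]
  have h2 : (0 : ℝ) < Fintype.card ({i : A // i ≠ basePoint A} → Bool) := by exact_mod_cast Fintype.card_pos
  push_cast
  rw [hpow]
  field_simp

/-- **The local law at `∞`**: `μ^log_{A,∞}((α,f)·S) = μ^log_{A,∞}(S) + (1/|𝕍(F)^arc|)·Σ_{w|∞} log|f|_w`
(abc-iut-w5-d178's `packetLogVol_image_tprod_mul` + the counting above). [claim: Mochizuki2012, status: disputed] -/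
theorem archCapsuleLogVolume_act (α : A) (f : Fˣ) (S : ArchCapsuleRegion F A) :
    archCapsuleLogVolume F A (archCapsuleAct F A α f S) =
      archCapsuleLogVolume F A S +
        (Fintype.card (InfinitePlace F) : ℝ)⁻¹ * ∑ w : InfinitePlace F, Real.log (w (f : F)) := by
  classical
  rw [archCapsuleLogVolume, archCapsuleAct_val,
    packetLogVol_image_tprod_mul (archFactor F A α f) (archFactor_ne_zero F A α f) S.2.1 S.2.2,
    archCapsuleLogVolume, add_comm]
  congr 1
  simp_rw [sum_log_norm_archFactor]
  exact idxAverage_eq F A α fun w => Real.log (w (f : F))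

/-- For `F` TOTALLY COMPLEX ([IUTchI] Def 3.1 (b)) the archimedean change is abc-iut-L6-d3's single-label
packet change: `(1/|𝕍^arc|)·Σ_w log|f|_w = Σ_w ([F_w:ℝ]/[F:ℚ])·log|f|_w` (`[F_w:ℝ] = 2`, `[F:ℚ] = 2|𝕍^arc|`).
[claim: Mochizuki2012, status: disputed] -/
theorem archChange_eq_sum_haarWeight (htc : ∀ w : InfinitePlace F, w.IsComplex) (f : Fˣ) :
    (Fintype.card (InfinitePlace F) : ℝ)⁻¹ * ∑ w : InfinitePlace F, Real.log (w (f : F)) =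
      ∑ w : InfinitePlace F, haarWeight F (Sum.inl w) * Real.log ((placeDatum F (Sum.inl w)).modulus (f : F)) := by
  have hmult : ∀ w : InfinitePlace F, w.mult = 2 := fun w => by
    rw [InfinitePlace.mult, if_neg (InfinitePlace.not_isReal_iff_isComplex.mpr (htc w))]
  have hdeg : (Module.finrank ℚ F : ℝ) = 2 * Fintype.card (InfinitePlace F) := by
    have h := InfinitePlace.sum_mult_eq (K := F)
    simp_rw [hmult, Finset.sum_const, Finset.card_univ, smul_eq_mul] at h
    rw [mul_comm]
    exact_mod_cast h.symm
  simp only [haarWeight_inl, placeDatum_inl, archDatum_modulus, hmult, hdeg, Nat.cast_ofNat, Finset.mul_sum]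
  refine Finset.sum_congr rfl fun w _ => ?_
  have hV : (Fintype.card (InfinitePlace F) : ℝ) ≠ 0 := by exact_mod_cast Fintype.card_pos.ne'
  field_simp

end Arch

/-! ### §4. The global capsule log-volume and [IUTchIII] Prop. 3.9 (iii) invariance for `|A| ≥ 1` -/

/-- The capsule regions at the rational place `v_ℚ`. [claim: Mochizuki2012, status: disputed] -/
def HaarCapsuleRegion : RatPlace → Type
  | Sum.inl _ => ArchCapsuleRegion F A
  | Sum.inr p => haveI : Fact (p : ℕ).Prime := ⟨p.2⟩; NonarchCapsuleRegion F A p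

/-- **`μ^log_{A,v_ℚ}` at the genuine model.** [claim: Mochizuki2012, status: disputed] -/
def haarCapsuleLogVolume : ∀ q : RatPlace, HaarCapsuleRegion F A q → ℝ
  | Sum.inl _, S => archCapsuleLogVolume F A S
  | Sum.inr p, T => by haveI : Fact (p : ℕ).Prime := ⟨p.2⟩; exact nonarchCapsuleLogVolume F A p T

/-- The action of `(α, f) ∈ A × F^×` ("multiplication by elements of `(†𝕄⊛_mod)_α`", through the `α`-th factor) at
`v_ℚ`. [claim: Mochizuki2012, status: disputed] -/
def haarCapsuleAct (a : A × Fˣ) : ∀ q : RatPlace, HaarCapsuleRegion F A q → HaarCapsuleRegion F A q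
  | Sum.inl _, S => archCapsuleAct F A a.1 a.2 S
  | Sum.inr p, T => by haveI : Fact (p : ℕ).Prime := ⟨p.2⟩; exact nonarchCapsuleAct F A p a.1 a.2 T

/-- The packet of archimedean places of `F` is `𝕍(F)^arc` (re-indexing). [claim: Mochizuki2012, status: disputed] -/
def archPacketEquiv : InfinitePlace F ≃ Packet F RatPlace.infty where
  toFun w := ⟨Sum.inl w, rfl⟩
  invFun v := match v with
    | ⟨Sum.inl w, _⟩ => w
    | ⟨Sum.inr _, h⟩ => absurd h (by simp [ratPlaceBelow])
  left_inv _ := rfl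
  right_inv v := by
    rcases v with ⟨w | v, h⟩
    · rfl
    · exact absurd h (by simp [ratPlaceBelow])

/-- The packet of places of `F` over a prime `p` is `V(F)_p` (re-indexing). [claim: Mochizuki2012, status: disputed] -/
def primePacketEquiv (p : Nat.Primes) :
    haveI : Fact (p : ℕ).Prime := ⟨p.2⟩; ↥(placesOver F (p : ℕ)) ≃ Packet F (RatPlace.prime p) :=
  haveI : Fact (p : ℕ).Prime := ⟨p.2⟩
  { toFun := fun w => ⟨Sum.inr w.1, (ratPlaceBelow_inr_eq_prime_iff F w.1 p).mpr w.2⟩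
    invFun := fun v => match v with
      | ⟨Sum.inl _, h⟩ => absurd h (by simp [ratPlaceBelow])
      | ⟨Sum.inr v, h⟩ => ⟨v, (ratPlaceBelow_inr_eq_prime_iff F v p).mp h⟩
    left_inv := fun _ => rfl
    right_inv := fun v => by
      rcases v with ⟨w | v, h⟩
      · exact absurd h (by simp [ratPlaceBelow])
      · rfl }

/-- **The local law at every `v_ℚ`, for `F` totally complex**: the capsule packet `μ^log_{A,v_ℚ}` moves under
`(α, f)` by EXACTLY abc-iut-L6-d3's single-label packet change `Σ_{v|v_ℚ} c_v·log‖f‖_v` (`packetLogModulus F f v_ℚ`).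
[claim: Mochizuki2012, status: disputed] -/
theorem haarCapsuleLogVolume_act (htc : ∀ w : InfinitePlace F, w.IsComplex) (a : A × Fˣ) :
    ∀ (q : RatPlace) (R : HaarCapsuleRegion F A q),
      haarCapsuleLogVolume F A q (haarCapsuleAct F A a q R) = haarCapsuleLogVolume F A q R + packetLogModulus F a.2 q
  | Sum.inl u, S => by
    rcases u with ⟨⟩
    change archCapsuleLogVolume F A (archCapsuleAct F A a.1 a.2 S) = archCapsuleLogVolume F A S + _
    rw [archCapsuleLogVolume_act, archChange_eq_sum_haarWeight F htc, packetLogModulus,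
      ← Equiv.sum_comp (archPacketEquiv F)]
    rfl
  | Sum.inr p, T => by
    haveI : Fact (p : ℕ).Prime := ⟨p.2⟩
    change nonarchCapsuleLogVolume F A p (nonarchCapsuleAct F A p a.1 a.2 T) = nonarchCapsuleLogVolume F A p T + _
    rw [nonarchCapsuleLogVolume_act, packetLogModulus, ← Equiv.sum_comp (primePacketEquiv F p)]
    rfl

/-- **[IUTchIII] Prop. 3.9 (iii) "multiplication by elements of `(†𝕄⊛_mod)_α`" at the genuine capsule model**:
`(α, f)` acts on a global capsule region placewise; "zero log-volume for all but finitely many `v_ℚ`" is kept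
(`‖f‖_v ≠ 1` at finitely many `v`; `∞` is one place). [claim: Mochizuki2012, status: disputed] -/
def haarCapsulePrincipalAction (a : A × Fˣ) (S : GlobalRegion (haarCapsuleLogVolume F A)) :
    GlobalRegion (haarCapsuleLogVolume F A) :=
  ⟨fun q => haarCapsuleAct F A a q (S.1 q), by
    refine ((S.2.union (finite_support_packetLogModulus F a.2)).union
      (Set.finite_singleton RatPlace.infty)).subset fun q hq => ?_
    by_contra hq'
    simp only [Set.mem_union, not_or, Function.notMem_support, Set.mem_singleton_iff] at hq'
    apply Function.mem_support.mp hq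
    rcases q with ⟨⟨⟩⟩ | p
    · exact absurd rfl hq'.2
    · haveI : Fact (p : ℕ).Prime := ⟨p.2⟩
      obtain ⟨⟨h1, h2⟩, -⟩ := hq'
      have hmod : ∑ w : placesOver F (p : ℕ), 1 / (Module.finrank ℚ F : ℝ) *
          Real.log (NumberField.HeightOneSpectrum.adicAbv F w.1 (a.2 : F) : ℝ) = packetLogModulus F a.2 (Sum.inr p) := by
        rw [packetLogModulus, ← Equiv.sum_comp (primePacketEquiv F p)]
        rfl
      change nonarchCapsuleLogVolume F A p (nonarchCapsuleAct F A p a.1 a.2 (S.1 (Sum.inr p))) = 0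
      change nonarchCapsuleLogVolume F A p (S.1 (Sum.inr p)) = 0 at h1
      rw [nonarchCapsuleLogVolume_act, h1, zero_add, hmod, h2]⟩

/-- **IUTchIII:Prop3.9(iii)** (kurims p. 117) INVARIANCE CLAUSE AT THE GENUINE CAPSULE MODEL, `|A| ≥ 1`, `F` totally complex:
`Prop39iii_invariance (haarCapsuleLogVolume F A) (haarCapsulePrincipalAction F A)` — the global log-volume
`Σ_{v_ℚ} μ^log_{A,v_ℚ}` of a capsule region of `𝓘^ℚ(^A𝓕_{𝕍_ℚ})` (genuine tensor packets `⊗_α ⊕_{v|v_ℚ} F_v`: rescaled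
completions over `ℚ_p`, abc-iut-L5-t7's `M_A` at `∞`) is invariant under multiplication by every `f ∈ F^×` through every
label `α` — abc-iut-L6-t5's `Prop39iii_invariance_of_productFormula` fed with the local laws (`haarCapsuleLogVolume_act`:
one-factor Haar scaling + Rmk 3.1.1 (ii) regrouping) and abc-iut-L6-d3's product formula regrouped by rational places
(`finsum_packetLogModulus_eq_zero`). [claim: Mochizuki2012, status: disputed] -/
theorem prop39iii_invariance_haarModelCapsules (htc : ∀ w : InfinitePlace F, w.IsComplex) :
    Prop39iii_invariance (haarCapsuleLogVolume F A) (haarCapsulePrincipalAction F A) :=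
  Prop39iii_invariance_of_productFormula (haarCapsuleLogVolume F A) (haarCapsulePrincipalAction F A)
    (fun a => packetLogModulus F a.2) (fun a => finite_support_packetLogModulus F a.2)
    (fun a => finsum_packetLogModulus_eq_zero F a.2)
    (fun a S q => haarCapsuleLogVolume_act F A htc a q (S.1 q))

/-- The invariance unfolded: `μ^log_{A,𝕍_ℚ}((α,f)·S) = μ^log_{A,𝕍_ℚ}(S)`. [claim: Mochizuki2012, status: disputed] -/
theorem globalLogVolume_haarCapsulePrincipalAction (htc : ∀ w : InfinitePlace F, w.IsComplex) (a : A × Fˣ)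
    (S : GlobalRegion (haarCapsuleLogVolume F A)) :
    globalLogVolume (haarCapsuleLogVolume F A) (haarCapsulePrincipalAction F A a S) =
      globalLogVolume (haarCapsuleLogVolume F A) S :=
  prop39iii_invariance_haarModelCapsules F A htc a S

end Literature.IUT.LogThetaLattice

end
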